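import Mathlib.NumberTheory.LocalField.Basic
import Mathlib.LinearAlgebra.Matrix.GeneralLinearGroup.Defs
import Mathlib.Topology.Algebra.Group.Matrix
import Mathlib.Topology.Instances.Matrix
import Mathlib.Algebra.MonoidAlgebra.Basic
import Mathlib.LinearAlgebra.RootSystem.Defs
import Mathlib.LinearAlgebra.FreeModule.Basic
import Mathlib.LinearAlgebra.FreeModule.Finite.Basic
import Mathlib.RepresentationTheory.Irreducible
import Literature.NumberTheory.Automorphic.LParameter
import Literature.NumberTheory.Automorphic.HeckeAlgebra
import Literature.NumberTheory.Automorphic.SmoothRepresentation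
import Literature.NumberTheory.GaloisRepresentations.LocalField
import HarnessLib

-- D-0014 sorry-sweep (operator, 2026-08-13): sorried theorems -> named facts `def X : Prop`; partial proofs preserved in comments
-- provenance: harness21/H21/H21/Prelude/AutomorphicAxiomatic/ReductiveGroupData.lean @ 0631ff5 (interim HEAD d8f2665); M5 mechanical rewrite
/-!
# Axiomatic connected reductive groups over a non-archimedean local field

Trunk G19 (AutomorphicAxiomatic), item C6.  Mathlib has no algebraic groups, so (TRUNKS design
1(c)) a *connected reductive group `G` over a non-archimedean local field `F`* is recorded as a
hypothesis structure `ConnectedReductiveGroupData F` bundling exactly what the target statements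
of this trunk consume:

* the topological group `Points = G(F)`;
* an L-group datum `lGroup : LGroupData F` (`Ĝ ⋊ Γ_F`, accepted module `LParameter`);
* the cocharacter lattice `Cochar = X_*(A)` of a maximal `F`-split torus `A` (a finite free
  `ℤ`-module) with its (relative) Weyl group `weylGroup ≤ Aut_ℤ(X_*(A))` — the data of the
  target of the Satake isomorphism `ℋ(G, K) ≃ ℂ[X_*(A)]^W`;
* the set `hyperspecial` of hyperspecial maximal compact (open) subgroups of `G(F)`.

By intent `Cochar`/`weylGroup` are the coweight lattice and Weyl group of a Mathlib
`RootPairing` (`Mathlib/LinearAlgebra/RootSystem/Defs.lean`, `RootPairing.weylGroup :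
Subgroup (Aut P)`); we do not record the root datum since no target statement uses it.

The structure is instantiated honestly (all fields have real proofs) by `GL n` (`.gl n F`,
hyperspecial subgroup `GL n 𝒪_F = glInt n F`, Weyl group `S_n` acting on `ℤⁿ`) and by the
units `Dˣ` of an `F`-algebra `D` (`.quaternionUnits`, intended for quaternion division
algebras: anisotropic mod centre, so `Cochar = X_*(Z) = ℤ`, trivial Weyl group, no
hyperspecial subgroups).

We also define the ring of Weyl invariants `weylInvariants k X W = k[X]^W ⊆ AddMonoidAlgebra k X`
and the *statement shapes* (untagged `def … : Prop`, outline D1) of the Satake isomorphism and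
of Jacquet's admissibility theorem for a general datum; they are asserted as theorems only for
the honest instances (module `SatakeParametersGL`).

## Mathlib searches

`ReductiveGroup`, `Hyperspecial`, `Satake`, `glInt`/`GL n 𝒪` : none in Mathlib.  Used from
Mathlib: `IsNonarchimedeanLocalField`, `Valuation.isOpen_integer`, `CompactSpace 𝒪[K]`,
`Matrix.GeneralLinearGroup.map`, `LinearEquiv.automorphismGroup`, `LinearEquiv.funCongrLeft`,
`AddMonoidAlgebra.domCongr`, `AlgHom.equalizer`, `Representation.IsIrreducible`.

## Design notes

* `weylGroup : Subgroup (Cochar ≃ₗ[ℤ] Cochar)` rather than `Subgroup (AddAut Cochar)`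
  (review F9): in this Mathlib `AddAut X` is only an *additive* group, so `Subgroup (AddAut X)`
  does not typecheck; `X ≃ₗ[ℤ] X` carries `LinearEquiv.automorphismGroup`.
* Universe discipline: `Points : Type u` (the universe of `F`), `Cochar : Type`; the structure
  lives in `Type (u + 1)`.  `JacquetAdmissibilityStatement G` quantifies over representation
  spaces in the universe of `G`.
* `ConnectedReductiveGroupData F` and `.quaternionUnits F D` keep the (formally unused)
  hypotheses `[IsNonarchimedeanLocalField F]`, `[Algebra F D]` as explicit binders
  (`nolint unusedArguments`): they are part of the mathematical input.  `glInt n F` and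
  `mem_glInt_iff` only need `[Field F] [ValuativeRel F]`.
* All declarations are in `namespace Literature.Automorphic` (review F2).

## References

* A. Borel, *Automorphic L-functions*, Proc. Symp. Pure Math. 33 (Corvallis 1979), part 2,
  §§3, 10.
* J. Tits, *Reductive groups over local fields*, Corvallis 1979, part 1, §3.8 (hyperspecial).
* P. Cartier, *Representations of p-adic groups: a survey*, Corvallis 1979, part 1, §IV.
* H. Jacquet, *Sur les représentations des groupes réductifs p-adiques*, C. R. Acad. Sci. 280
  (1975); Bernstein–Zelevinsky 1976, §3.
-/

universe u

open Matrix ValuativeRel Topology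
open scoped MatrixGroups

namespace Literature.NumberTheory.Automorphic

/-! ### The hypothesis structure -/

section Data

/-- A **connected reductive group over the non-archimedean local field `F`**, axiomatised by the
data the statements of this trunk consume: the topological group `Points = G(F)`, an L-group
datum `lGroup` (`Ĝ ⋊ Γ_F`), the cocharacter lattice `Cochar = X_*(A)` of a maximal `F`-split torus
with its relative Weyl group `weylGroup ≤ Aut_ℤ X_*(A)` (by intent the coweight lattice and Weyl
group of a Mathlib `RootPairing`), and the set of hyperspecial maximal compact subgroups, which
are open.  Ref: Borel, *Automorphic L-functions* (Corvallis 1979), §§3, 10; Tits, *Reductive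
groups over local fields* (Corvallis 1979), §3.8.

The local-field hypotheses on `F` are explicit binders: formally only `[Field F]` is used (by
`lGroup`), but the datum (hyperspecial subgroups, the Satake target) is only meaningful over a
non-archimedean local field, so we require it, as the instances `.gl`/`.quaternionUnits` and
all consumers do. [cite: Corvallis1979] -/
@[nolint unusedArguments]
structure ConnectedReductiveGroupData (F : Type u) [Field F] [ValuativeRel F] [TopologicalSpace F]
    [IsNonarchimedeanLocalField F] : Type (u + 1) where
  /-- The group `G(F)` of `F`-points. -/
  Points : Type u
  /-- `G(F)` is a group. -/
  [group : Group Points]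
  /-- The (locally profinite) topology of `G(F)`. -/
  [top : TopologicalSpace Points]
  /-- `G(F)` is a topological group. -/
  [topGroup : IsTopologicalGroup Points]
  /-- The L-group `ᴸG = Ĝ ⋊ Γ_F`. -/
  lGroup : LGroupData F
  /-- The cocharacter lattice `X_*(A)` of a maximal `F`-split torus `A ≤ G`. -/
  Cochar : Type
  /-- `X_*(A)` is an abelian group. -/
  [cocharGroup : AddCommGroup Cochar]
  /-- `X_*(A)` is finitely generated. -/
  [cocharFinite : Module.Finite ℤ Cochar]
  /-- `X_*(A)` is free. -/
  [cocharFree : Module.Free ℤ Cochar]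
  /-- The relative Weyl group `W = N_G(A)/Z_G(A)` acting faithfully on `X_*(A)`. -/
  weylGroup : Subgroup (Cochar ≃ₗ[ℤ] Cochar)
  /-- The hyperspecial maximal compact subgroups of `G(F)` (empty unless `G` is unramified). -/
  hyperspecial : Set (Subgroup Points)
  /-- Hyperspecial subgroups are open. -/
  isOpen_of_mem_hyperspecial : ∀ K ∈ hyperspecial, IsOpen (K : Set Points)

attribute [instance] ConnectedReductiveGroupData.group ConnectedReductiveGroupData.top
  ConnectedReductiveGroupData.topGroup ConnectedReductiveGroupData.cocharGroup
  ConnectedReductiveGroupData.cocharFinite ConnectedReductiveGroupData.cocharFree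

end Data

/-! ### `GL n 𝒪_F` -/

section GLInt

variable (n : ℕ) (F : Type u) [Field F] [ValuativeRel F]

/-- The subgroup `GL n 𝒪_F ≤ GL n F` of integral invertible matrices with integral inverse: the
image of `GL n 𝒪[F]` under the map induced by `𝒪[F] ↪ F`.  It is a hyperspecial maximal compact
open subgroup.  Ref: Cartier, *Representations of p-adic groups* (Corvallis 1979), §IV.1;
Tits (Corvallis 1979), §3.8. [cite: Corvallis1979] -/
noncomputable def glInt : Subgroup (GL (Fin n) F) :=
  (Matrix.GeneralLinearGroup.map (𝒪[F]).subtype).range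

variable {n F}

/-- `g ∈ GL n 𝒪_F` iff all entries of `g` and of `g⁻¹` are integral. [folklore] -/
theorem mem_glInt_iff (g : GL (Fin n) F) :
    g ∈ glInt n F ↔ (∀ i j, (g : Matrix (Fin n) (Fin n) F) i j ∈ 𝒪[F]) ∧
      ∀ i j, ((g⁻¹ : GL (Fin n) F) : Matrix (Fin n) (Fin n) F) i j ∈ 𝒪[F] := by
  constructor
  · rintro ⟨u, rfl⟩
    refine ⟨fun i j => ?_, fun i j => ?_⟩
    · exact (u.1 i j).2
    · rw [← map_inv]
      exact (u⁻¹.1 i j).2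
  · rintro ⟨hg, hg'⟩
    have hinj : Function.Injective (𝒪[F].subtype.mapMatrix :
        Matrix (Fin n) (Fin n) 𝒪[F] → Matrix (Fin n) (Fin n) F) :=
      Matrix.map_injective Subtype.val_injective
    let A : Matrix (Fin n) (Fin n) 𝒪[F] := Matrix.of fun i j => ⟨_, hg i j⟩
    let B : Matrix (Fin n) (Fin n) 𝒪[F] := Matrix.of fun i j => ⟨_, hg' i j⟩
    have hA : 𝒪[F].subtype.mapMatrix A = (g : Matrix (Fin n) (Fin n) F) := rfl
    have hB : 𝒪[F].subtype.mapMatrix B = ((g⁻¹ : GL (Fin n) F) : Matrix (Fin n) (Fin n) F) := rfl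
    refine ⟨⟨A, B, hinj ?_, hinj ?_⟩, ?_⟩
    · rw [map_mul, map_one, hA, hB, ← Units.val_mul, mul_inv_cancel, Units.val_one]
    · rw [map_mul, map_one, hA, hB, ← Units.val_mul, inv_mul_cancel, Units.val_one]
    · exact Units.ext hA

variable (n F) [TopologicalSpace F] [IsNonarchimedeanLocalField F]

/-- `GL n 𝒪_F` is open in `GL n F` (real proof: `𝒪[F]` is open in `F` and matrix entries of `g`
and `g⁻¹` are continuous on `GL n F`).  Ref: Cartier (Corvallis 1979), §IV.1. [cite: Corvallis1979] -/
theorem isOpen_glInt : IsOpen (glInt n F : Set (GL (Fin n) F)) := by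
  have h : (glInt n F : Set (GL (Fin n) F)) =
      (⋂ i, ⋂ j, (fun g : GL (Fin n) F => (g : Matrix (Fin n) (Fin n) F) i j) ⁻¹' (𝒪[F] : Set F)) ∩
      ⋂ i, ⋂ j, (fun g : GL (Fin n) F => ((g⁻¹ : GL (Fin n) F) : Matrix (Fin n) (Fin n) F) i j) ⁻¹'
        (𝒪[F] : Set F) := by
    ext g
    simp only [SetLike.mem_coe, mem_glInt_iff, Set.mem_inter_iff, Set.mem_iInter,
      Set.mem_preimage]
  rw [h]
  refine IsOpen.inter (isOpen_iInter_of_finite fun i => isOpen_iInter_of_finite fun j => ?_)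
    (isOpen_iInter_of_finite fun i => isOpen_iInter_of_finite fun j => ?_)
  · exact Valuation.isOpen_integer.preimage (Units.continuous_val.matrix_elem i j)
  · exact Valuation.isOpen_integer.preimage (Units.continuous_coe_inv.matrix_elem i j)

/-- `GL n 𝒪_F` is compact (it is the continuous image of the compact group `GL n 𝒪[F]`, `𝒪[F]`
being compact).  Ref: Cartier (Corvallis 1979), §IV.1. [cite: Corvallis1979] -/
theorem isCompact_glInt : IsCompact (glInt n F : Set (GL (Fin n) F)) := by
  -- `F` is Hausdorff: go through Mathlib's helper `Valued` instance, as in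
  -- `Mathlib/NumberTheory/LocalField/Basic.lean`.
  letI := IsTopologicalAddGroup.rightUniformSpace F
  haveI := isUniformAddGroup_of_addCommGroup (G := F)
  haveI : CompactSpace (Matrix (Fin n) (Fin n) 𝒪[F]) :=
    inferInstanceAs (CompactSpace (Fin n → Fin n → 𝒪[F]))
  rw [glInt, MonoidHom.coe_range]
  exact isCompact_range (Units.continuous_map (continuous_id.matrix_map continuous_subtype_val))

/-- `GL n 𝒪_F` is a *maximal* compact subgroup of `GL n F`: a compact subgroup containing it
equals it.  Ref: Cartier (Corvallis 1979), §IV.1; Tits (Corvallis 1979), §§3.2, 3.8. [cite: Corvallis1979] -/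
def glInt_isMaximalCompactOpen : Prop :=
  ∀ (K : Subgroup (GL (Fin n) F)) (hK : IsCompact (K : Set (GL (Fin n) F))) (hle : glInt n F ≤ K),
    K = glInt n F

end GLInt

/-! ### Weyl invariants -/

section WeylInvariants

variable (k X : Type*) [CommRing k] [AddCommGroup X] (W : Subgroup (X ≃ₗ[ℤ] X))

/-- The subalgebra `k[X]^W ⊆ k[X]` of invariants of a group `W` of automorphisms of the lattice
`X` acting on the group algebra `k[X] = AddMonoidAlgebra k X` (through
`AddMonoidAlgebra.domCongr`): the target `ℂ[X_*(A)]^W ≅ ℋ(A, A(𝒪))^W` of the Satake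
isomorphism.  Ref: Cartier (Corvallis 1979), §IV.2, Theorem 4.1; Borel (Corvallis 1979), §7. [cite: Corvallis1979] -/
noncomputable def weylInvariants : Subalgebra k (AddMonoidAlgebra k X) :=
  ⨅ w ∈ W, AlgHom.equalizer
    ((AddMonoidAlgebra.domCongr k k (w : X ≃ₗ[ℤ] X).toAddEquiv).toAlgHom) (AlgHom.id k _)

variable {k X W} in
/-- `f ∈ k[X]^W` iff `f` is fixed by (the domain congruence along) every `w ∈ W`. [folklore] -/
theorem mem_weylInvariants_iff (f : AddMonoidAlgebra k X) :
    f ∈ weylInvariants k X W ↔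
      ∀ w ∈ W, AddMonoidAlgebra.domCongr k k (w : X ≃ₗ[ℤ] X).toAddEquiv f = f := by
  simp [weylInvariants, Algebra.mem_iInf, AlgHom.mem_equalizer]

end WeylInvariants

/-! ### Instances: `GL n` and units of (quaternion) algebras -/

namespace ConnectedReductiveGroupData

variable (n : ℕ) (F : Type u) [Field F] [ValuativeRel F] [TopologicalSpace F]
  [IsNonarchimedeanLocalField F]

/-- The Weyl group `S_n` of `GL n`, as the subgroup of `Aut_ℤ(ℤⁿ)` generated by the coordinate
permutations `LinearEquiv.funCongrLeft ℤ ℤ σ`.  Ref: Borel (Corvallis 1979), §7, Example. [cite: Corvallis1979] -/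
def glWeylGroup : Subgroup ((Fin n → ℤ) ≃ₗ[ℤ] (Fin n → ℤ)) :=
  Subgroup.closure (Set.range fun σ : Equiv.Perm (Fin n) => LinearEquiv.funCongrLeft ℤ ℤ σ)

/-- The connected reductive group datum of `GL n / F`: points `GL n F` with its matrix topology,
L-group `GL n ℂ × Γ_F` (`LGroupData.gl`), cocharacter lattice `ℤⁿ` of the diagonal torus with
Weyl group `S_n`, and the single hyperspecial subgroup `GL n 𝒪_F` (all hyperspecial subgroups
of `GL n F` are conjugate to it).  Ref: Borel (Corvallis 1979), §§3, 7, 10; Cartier (Corvallis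
1979), §IV.1. [cite: Corvallis1979] -/
noncomputable def gl : ConnectedReductiveGroupData F where
  Points := GL (Fin n) F
  lGroup := LGroupData.gl F n
  Cochar := Fin n → ℤ
  weylGroup := glWeylGroup n
  hyperspecial := {glInt n F}
  isOpen_of_mem_hyperspecial K hK := by
    rw [Set.mem_singleton_iff] at hK
    exact hK ▸ isOpen_glInt n F

/-- The hyperspecial subgroups of the `GL n` datum are `{GL n 𝒪_F}`. [folklore] -/
@[simp]
theorem gl_hyperspecial : (gl n F).hyperspecial = {glInt n F} := rfl

/-- The connected reductive group datum of the unit group `Dˣ` of a (quaternion division)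
`F`-algebra `D`, an anisotropic-mod-centre inner form of `GL₂`: points `Dˣ` (topology induced
from `D`, supplied by the caller — typically the `F`-module topology), L-group `GL₂(ℂ) × Γ_F`,
cocharacter lattice `X_*(Z) = ℤ` of the maximal split torus (the centre), trivial Weyl group and
no hyperspecial subgroups (`Dˣ` is ramified).  The `F`-algebra structure on `D` is not used
formally but is part of the intended input.  Ref: Borel (Corvallis 1979), §§3, 10;
Tits (Corvallis 1979), §3.8. [cite: Corvallis1979] -/
@[nolint unusedArguments]
noncomputable def quaternionUnits (D : Type u) [Ring D] [Algebra F D] [TopologicalSpace D]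
    [IsTopologicalRing D] : ConnectedReductiveGroupData F where
  Points := Dˣ
  lGroup := LGroupData.gl F 2
  Cochar := ℤ
  weylGroup := ⊥
  hyperspecial := ∅
  isOpen_of_mem_hyperspecial K hK := absurd hK (Set.notMem_empty K)

/-- The datum `Dˣ` has no hyperspecial subgroups. [folklore] -/
@[simp]
theorem quaternionUnits_hyperspecial (D : Type u) [Ring D] [Algebra F D] [TopologicalSpace D]
    [IsTopologicalRing D] : (quaternionUnits F D).hyperspecial = ∅ := rfl

end ConnectedReductiveGroupData

/-! ### Statement shapes for a general datum (untagged, outline D1) -/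

section Statements

variable {F : Type u} [Field F] [ValuativeRel F] [TopologicalSpace F] [IsNonarchimedeanLocalField F]

/-- The **Satake isomorphism** for the datum `G` and the subgroup `K`, as a statement: if `K` is
hyperspecial then the Hecke algebra `ℋ(G(F), K)` over `ℂ` is isomorphic, as a `ℂ`-algebra, to
the Weyl invariants `ℂ[X_*(A)]^W`.  Untagged statement shape (outline D1): asserted as a theorem
only for honest instances.  Ref: Cartier (Corvallis 1979), §IV.2, Theorem 4.1 (Satake 1963). [cite: Corvallis1979] -/
def SatakeIsomorphismStatement (G : ConnectedReductiveGroupData F) (K : Subgroup G.Points) :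
    Prop :=
  K ∈ G.hyperspecial →
    Nonempty (heckeAlgebra ℂ G.Points K ≃ₐ[ℂ] weylInvariants ℂ G.Cochar G.weylGroup)

/-- **Jacquet's admissibility theorem** for the topological group `G`, as a statement: every
smooth irreducible complex representation of `G` is admissible.  The representation spaces range
over the universe of `G`.  Untagged statement shape (outline D1).  Ref: Jacquet, C. R. Acad. Sci.
280 (1975); Bernstein–Zelevinsky, *Representations of the group `GL(n, F)`* (1976), §3.25;
Cartier (Corvallis 1979), §II. [cite: Corvallis1979] -/
def JacquetAdmissibilityStatement (G : Type u) [Group G] [TopologicalSpace G] : Prop :=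
  ∀ (V : Type u) [AddCommGroup V] [Module ℂ V] (ρ : Representation ℂ G V),
    ρ.IsSmooth → ρ.IsIrreducible → ρ.IsAdmissible

/-- **Unramified duality** for the datum `G` and the subgroup `K`, as a statement: if `K` is
hyperspecial, a smooth irreducible complex representation with a non-zero `K`-fixed vector has a
one-dimensional space of `K`-fixed vectors (so unramified irreducibles correspond to characters
of the commutative algebra `ℋ(G(F), K)`).  Untagged statement shape (outline D1).
Ref: Cartier (Corvallis 1979), §IV.1, Corollary 4.1 and §IV.4. [cite: Corvallis1979] -/
def UnramifiedDualityStatement (G : ConnectedReductiveGroupData F) (K : Subgroup G.Points) :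
    Prop :=
  K ∈ G.hyperspecial → ∀ (V : Type u) [AddCommGroup V] [Module ℂ V]
    (ρ : Representation ℂ G.Points V), ρ.IsSmooth → ρ.IsIrreducible → ρ.IsUnramified K →
      ρ.IsSpherical K

end Statements

end Literature.NumberTheory.Automorphic
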